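/-
Copyright (c) 2026 the pub-hodgecm-mathlib formalisation cell (harness21).  Prover seat hodgecm-mathlib-LH4-p16 (g2), req620 Track A «(D-RAM) FOUR-FRAME» squad
(STAGE-1b, row (2) of the piece `f_{T₊}`, the (β₂) road (R-36) «PURE-CELL LEDGER, RELATIVE SIGNS»; β₂ sub-dealer LH4-p04 (g9) (L-Σ-3B)∕(L-Σ-3C) «OFF-ROW ZERO + ROW»,
lane-C hinge LH7-p10 (g2); the (κ-b) row of the RamM ledger, the near cell `K₀` at the FLIP DIGIT; MECH-K0 v2 2d5a3e86), 2026-09-04.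
-/
import Summits.HodgeConjecture.HodgeConjecture.Theorems.F0P3cDyRamRayScalarBoundaryTerm     -- ★ p862205∕p862234 (this lineage): `trace_div_eq_main_add_boundary`, `v_gen_mul_add_map_eq_of_lt`, `v_gen_mul_add_map_le`; brings ★ p861810, ★ p861653, ★ p861454, ★ p861372 HEAD B, ★ p861637
import Summits.HodgeConjecture.HodgeConjecture.Theorems.F0P3cDyRamLabelShellFlipCardTwo      -- ★ p861900∕p862206 (LH4-p15 (g0)) §5: `v_refSkew_eq`, (S0″) `valueSetMod_smul_xPlus_eq_of_v_sub_le_pred`, (S1″) `valueSetMod_smul_xPlus_eq_twist_of_v_sub_eq_shell'`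
import Summits.HodgeConjecture.HodgeConjecture.Theorems.F0P3cDyRamDiagonalCellCleanRegime     -- ★ p861813 (LH4-p19 (g0)): `v_map_le_pow_iff`, `v_eq_pow_of_map_eq` (transport of `ϖ`-digits across `jE`)
import Summits.HodgeConjecture.HodgeConjecture.Theorems.F0P3cDyRamDiagonalCellCrossLiteral    -- ★ (LH4-p19 (g0)): `exists_norm_mul_iff_of_norm`; brings ★ `isAdicComplete_valuedInteger_of_completeSpace`
import HarnessLib

/-!
# Crux `H413`, line LH4 «(D-RAM) FOUR-FRAME» — STAGE-1b, row (2), the (β₂) road (R-36), lane C row (κ-b): «THE LETTER OF A RAY VERTEX AT THE FLIP DIGIT IS `(c·e) • X₊`»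

Cell `hodgecm-mathlib` (D-0151), FLOOR 0, crux item H413 = `stmt-HodgeConjecture-24833`, route of record `HCCMUnconditional`; squad F0∕P3c∕LH4; lane
`--supports stmt-HodgeConjecture-24833 --as helper` (count-neutral; pays NO tier-0 row).  THEOREMS ONLY (no `def`, no instance, no notation, no `sorry`, default heartbeats);
★-only imports; states NO law; (β₂) stays a HYPOTHESIS.  DATUM-LIGHT: §1–§3 are valuation algebra on `(E, σ, ϖ)` and the embedding `jE : E → M` with `ρ`; §4 is ★ p861372
HEAD B's frame (plane `(E², H₂)`, block form `block(H₂, h_W)`, `Γ = endoGL (γ₂, u)`, ★ (C1)'s line model `(M, jE, ρ, Θ; φ, lam, h_M)`) PLUS the ray-domination letters of ★ p861653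
(`hYO hμ hμt hmm` at the modulus `m* = mstarOfRecord d`) PLUS the sheet datum `IsRamifiedQuadraticDatum σ ϖ d t` on `E` (`q = #𝓀[E] = 2` for the flip, ★ p862206 (S1″)).  NO `hlam`:
★ p861810's `E`-dominance letter is REPLACED by the exact boundary term of ★ p862205; the cell enters only through the DICTIONARY EQUATIONS `hk` + `hflip` (resp. `hclean`),
which the cell dictionary (★ p862235 `v_cellScalar_*`, ★ p861491 tokens, ★ `hk_of_lt`) discharges per cell.
WHY (MECH-K0 v2 `F0/P3c/LH4/LH4-p16/g0/MECH-K0.v2.LH4p16g0.md` §2–§3; LH4-cdis1 (g0) RamM table (κ-b) «`K₀,ℓ = −D_ℓ` at `δ = 2d`»; F0P3-p01 (g37) 22:18:32Z «the unbalanced RamM cells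
sit on ONE row: `D`, `K₀`, the first tower cell»; β₂ sub-dealer LH4-p04 (g9) 22:17:22Z «OFF-ROW ZERO + ROW»).  By ★ p861653 `normFormSet_eq_ray_of_isOrd` the census letter of a
vertex over an order-integral cell is the thickened `a`-ray of ONE scalar `e₀ = Tr_ρ(μ∕D₀) = jE(e₀′)`, `μ = lam − jE u₀₀`; ★ p862205 splits `e₀′ = μ_a·pw + μ_b·τ`
(`μ = jE μ_a + jE μ_b·α`, `jE pw = Tr_ρ(D₀⁻¹) = jE⟨w₀, w₀⟩`, `jE τ = Tr_ρ(α·D₀⁻¹)`), with `|jE τ| = |D₀|⁻¹·|α − ρα|` EXACTLY under `hk : |Tr_ρ D₀⁻¹| < |D₀⁻¹|·|α − ρα|` (★ `hk_of_lt`: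
order level > tube depth).  THIS FILE reads the main term through the glue and the clean `E`-letter: `μ_a·pw + μ_b·τ − t₊·e = μ_a·(pw + σg₁ h_W g₁) − (μ_a + f t₊ (ϖσϖ)^b)·σg₁ h_W g₁ + μ_b·τ`,
`e := f·h_W·N(ϖ^b g₁)` (§1), the first two of size `≤ |ϖ|^{2b + d%2}` (glue integrality) and `≤ |ϖ|^{n − 2b}` (`E`-precision `n`, §2); so for `b ≥ d`, `n ≥ 2b + m*` the digit of
`g − e`, `g := e₀′∕t₊`, IS the digit of `μ_b·τ∕t₊` (§3 reads `|μ_b·τ|` across `jE` from `hk` + `hflip`, or from `hclean` without `hk`):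
* CLEAN (`v_rayScalar_sub_le_of_clean`, HEAD′ `valueSet_endoGL_sub_one_glued_eq_smul_xPlus_of_clean`): `|jE μ_b|·max(|Tr_ρ D₀⁻¹|, |D₀|⁻¹|α − ρα|) ≤ |jEϖ|^{m*}` ⟹ `|g − e| ≤ |ϖ|^{2d−1}`
  ⟹ `VS_{m*} = valueSetMod σ ϖ m* (e • X₊)` ((S0″)) — ★ p861810's conclusion from a letter WEAKER than its `hlam` (`|α − ρα|` in place of `|α|`);
* FLIP (`v_rayScalar_sub_eq_of_flip`, HEAD `valueSet_endoGL_sub_one_glued_eq_twist_smul_xPlus_of_flip`): `hk` and `|jE μ_b|·|D₀|⁻¹·|α − ρα| = |jEϖ|^{2(d−1)+d%2}` ⟹ `|g − e| = |ϖ|^{2(d−1)}`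
  EXACTLY ⟹ at `q = 2`, `VS_{m*} = valueSetMod σ ϖ m* ((c·e) • X₊)` for every `σ`-fixed non-norm unit `c` ((S1″)): the `c`-TWIST of the clean letter, `d` of ANY parity;
* §5 labels: the flipped vertex is `+` iff `f·h_W ∉ N(E^×)`, the clean one iff `f·h_W ∈ N(E^×)` (★ p861454 §4 + «a norm factor does not move the class»).
WHAT IS NOT CLAIMED: which cells satisfy `hflip`∕`hclean` (RamM `K₀ = (a + s0, a)`, `(g, s0) = (2, 1)`: `v_E(μ_b) − v_E(D₀) + v_E(α − ρα) = 2(d−1) + d%2`, MECH-K0 v2 `12 − 8 + 1 = 5`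
at `d = 3`, `δ = 2d`, 8∕8 vertices), the `E`-letter `hμa` (★ `…ConeCellCleanRegimeDeep`, `d` even; `d` odd OPEN), the diagonal cell at the same `δ` (★ p862205 §3; `hk` fails there),
the cell bookkeeping (★ p861861), sizes (★ p861491), `q ≥ 4`.
HONEST LABEL.  Count-neutral valuation ∕ lattice algebra; nothing printed is asserted; no census law is stated; `HC_CM` is proved only modulo the 7 printed citations (2 remaining
named inputs: hLiu418 = `stmt-HodgeConjecture-24832`, h413 = `stmt-HodgeConjecture-24833`) until rung 0 closes.
## References
* [Serre1979] J.-P. Serre, *Local Fields*, GTM 67 (1979): Ch. III §6 Prop. 12, Ch. V §3 Prop. 5, Cor. 2–3, Ch. XV §2; [Jacobowitz1962] R. Jacobowitz, *Hermitian forms over local fields*, Amer. J. Math. 84 (1962): §4.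
* [Rogawski1990] J. D. Rogawski, *Automorphic Representations of Unitary Groups in Three Variables*, Ann. of Math. Stud. 123 (1990): §4.9 Prop. 4.9.1 (b) p. 55.
* [Kottwitz1986BaseChangeUnits] R. E. Kottwitz, *Base change for unit elements of Hecke algebras*, Compositio Math. 60 (1986): §1 pp. 240–241; [LanglandsShelstad1987] R. P. Langlands, D. Shelstad, *On the definition of transfer factors*, Math. Ann. 278 (1987): §1–§3.
-/

set_option autoImplicit false

noncomputable section

namespace Summit.HodgeConjecture.HodgeConjecture.Cruxes.H413.F0P3cDyRamNearCellFlippedLetter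

open scoped Valued WithZero Matrix MatrixGroups
open WithZero
open Literature.NumberTheory.Automorphic Literature.NumberTheory.Automorphic.HermitianLattice Literature.NumberTheory.Automorphic.UnitaryLatticeTree
open Literature.NumberTheory.Automorphic.UnitaryThreeFourFrame (IsRamifiedQuadraticDatum)
open Literature.NumberTheory.Rogawski1990
open Summit.HodgeConjecture.HodgeConjecture.Cruxes.H413.F0P3cDyRamFourFramePieces
open Summit.HodgeConjecture.HodgeConjecture.Cruxes.H413.F0P3cDyRamToricCensusDefs
open Summit.HodgeConjecture.HodgeConjecture.Cruxes.H413.F0P3cDyRamDepthFormLineModel (valueSet_endoGL_sub_one_glued_eq_normFormSet_of_gen)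
open Summit.HodgeConjecture.HodgeConjecture.Cruxes.H413.F0P3cDyRamNormFormRayDominated (normFormSet_eq_ray_of_isOrd)
open Summit.HodgeConjecture.HodgeConjecture.Cruxes.H413.F0P3cDyRamRayScalarBoundaryTerm (trace_div_eq_main_add_boundary v_gen_mul_add_map_eq_of_lt v_gen_mul_add_map_le)
open Summit.HodgeConjecture.HodgeConjecture.Cruxes.H413.F0P3cDyRamDiagonalCellLetter (inv_add_map_inv_eq_map_pairing)
open Summit.HodgeConjecture.HodgeConjecture.Cruxes.H413.F0P3cDyRamBlockGlueLabelFibreConstant (pairing_self_eq_plane_add_line)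
open Summit.HodgeConjecture.HodgeConjecture.Cruxes.H413.F0P3cDyRamLabelShellFlipCardTwo (v_refSkew_eq valueSetMod_smul_xPlus_eq_of_v_sub_le_pred
  valueSetMod_smul_xPlus_eq_twist_of_v_sub_eq_shell')
open Summit.HodgeConjecture.HodgeConjecture.Cruxes.H413.F0P3cDyRamDiagonalCellCleanRegime (v_map_le_pow_iff v_eq_pow_of_map_eq)
open Summit.HodgeConjecture.HodgeConjecture.Cruxes.H413.F0P3cDyRamDepthScalar (labelPlus_iff_exists_norm_of_ray labelPlus_map_iff_of_ray)
open Summit.HodgeConjecture.HodgeConjecture.Cruxes.H413.F0P3cDyRamDiagonalCellCrossLiteral (exists_norm_mul_iff_of_norm)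

variable {E M : Type} [Field E] [Valued E ℤᵐ⁰] [Field M] [Valued M ℤᵐ⁰] {ρ Θ : M →+* M} {α : M}

/-! ## §1 The ray scalar `e₀′ = μ_a·pw + μ_b·τ` against `t₊·e`: the main term through the glue and the clean `E`-letter -/

omit [Valued E ℤᵐ⁰] [Valued M ℤᵐ⁰] [Field M] in
/-- **THE MAIN TERM THROUGH THE GLUE AND THE CLEAN `E`-LETTER** (an identity in `E`): with `e := f·h_W·N(ϖ^b·g₁)`, `t` the skew scalar, `P = (ϖσϖ)^b`,
`μ_a·pw + μ_b·τ − t·e = μ_a·(pw + σg₁·h_W·g₁) − (μ_a + f·t·P)·(σg₁·h_W·g₁) + μ_b·τ`. [cite: Jacobowitz1962, §4] -/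
theorem main_sub_eq (σ : E →+* E) (ϖ f hW g₁ t pw τ μa μb : E) (b : ℕ) :
    μa * pw + μb * τ - t * (f * hW * ((ϖ ^ b * g₁) * σ (ϖ ^ b * g₁))) =
      μa * (pw + σ g₁ * hW * g₁) - (μa + f * t * (ϖ * σ ϖ) ^ b) * (σ g₁ * hW * g₁) + μb * τ := by
  rw [map_mul, map_pow]; ring

/-! ## §2 The two readings of `g − e`, `g = e₀′∕t₊`: CLEAN (`≤ |ϖ|^{2d−1}`) and FLIP (`= |ϖ|^{2(d−1)}` exactly) -/

/-- **THE SIZE OF THE TWO ERROR TERMS.**  With `|pw + σg₁ h_W g₁| ≤ 1`, `|ϖ^b g₁| = 1`, `|h_W| = 1`, `|f| ≤ 1`, `|t| = |ϖ|^{d%2}`, the `E`-letter `|μ_a + f t P| ≤ |ϖ|^n`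
(`P = (ϖσϖ)^b`) and `2b + d%2 ≤ n`: `|μ_a·(pw + σg₁ h_W g₁)| ≤ |ϖ|^{2b + d%2}` and `|(μ_a + f t P)·σg₁ h_W g₁|·|ϖ|^{2b} ≤ |ϖ|^n`. [cite: Jacobowitz1962, §4] [cite: Serre1979, Ch. V §3 Cor. 3] -/
theorem v_errors_le (σ : E →+* E) (hvσ : ∀ a, Valued.v (σ a) = Valued.v a) {ϖ : E} (hϖ : Valued.v ϖ = exp (-1 : ℤ))
    {pw g₁ hW f t μa : E} {b d n : ℕ} (hint : Valued.v (pw + σ g₁ * hW * g₁) ≤ 1) (hu : Valued.v (ϖ ^ b * g₁) = 1) (hh : Valued.v hW = 1)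
    (hf1 : Valued.v f ≤ 1) (ht : Valued.v t = Valued.v ϖ ^ (d % 2))
    (hμa : Valued.v (μa + f * t * (ϖ * σ ϖ) ^ b) ≤ Valued.v ϖ ^ n) (hn : 2 * b + d % 2 ≤ n) :
    Valued.v (μa * (pw + σ g₁ * hW * g₁)) ≤ Valued.v ϖ ^ (2 * b + d % 2) ∧
      Valued.v ((μa + f * t * (ϖ * σ ϖ) ^ b) * (σ g₁ * hW * g₁)) * Valued.v ϖ ^ (2 * b) ≤ Valued.v ϖ ^ n := by
  have hϖ1 : Valued.v ϖ ≤ 1 := by rw [hϖ, ← exp_zero, exp_le_exp]; norm_num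
  have hP : Valued.v ((ϖ * σ ϖ) ^ b) = Valued.v ϖ ^ (2 * b) := by
    rw [Valuation.map_pow, Valuation.map_mul, hvσ, ← pow_two, ← pow_mul, mul_comm]
  -- `|f t P| ≤ |ϖ|^{2b + d%2}`, hence `|μ_a| ≤ |ϖ|^{2b + d%2}`
  have hftP : Valued.v (f * t * (ϖ * σ ϖ) ^ b) ≤ Valued.v ϖ ^ (2 * b + d % 2) := by
    rw [Valuation.map_mul, Valuation.map_mul, hP, ht, pow_add]
    calc Valued.v f * Valued.v ϖ ^ (d % 2) * Valued.v ϖ ^ (2 * b) ≤ 1 * Valued.v ϖ ^ (d % 2) * Valued.v ϖ ^ (2 * b) := by gcongr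
      _ = Valued.v ϖ ^ (2 * b) * Valued.v ϖ ^ (d % 2) := by rw [one_mul, mul_comm]
  have hμa1 : Valued.v μa ≤ Valued.v ϖ ^ (2 * b + d % 2) := by
    have e : μa = (μa + f * t * (ϖ * σ ϖ) ^ b) - f * t * (ϖ * σ ϖ) ^ b := by ring
    rw [e]
    exact (Valuation.map_sub _ _ _).trans (max_le (hμa.trans (pow_le_pow_right_of_le_one' hϖ1 hn)) hftP)
  -- the line term: `|σg₁ h_W g₁|·|ϖ|^{2b} = 1`
  have hX : Valued.v (σ g₁ * hW * g₁) * Valued.v ϖ ^ (2 * b) = 1 := by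
    have hu' : Valued.v (ϖ ^ b * σ g₁) = 1 := by rw [Valuation.map_mul, hvσ, ← Valuation.map_mul]; exact hu
    have e : σ g₁ * hW * g₁ * ϖ ^ (2 * b) = hW * ((ϖ ^ b * g₁) * (ϖ ^ b * σ g₁)) := by ring
    rw [← Valuation.map_pow, ← Valuation.map_mul, e, Valuation.map_mul, Valuation.map_mul, hh, hu, hu', one_mul, one_mul]
  refine ⟨?_, ?_⟩
  · rw [Valuation.map_mul]
    calc Valued.v μa * Valued.v (pw + σ g₁ * hW * g₁) ≤ Valued.v ϖ ^ (2 * b + d % 2) * 1 := by gcongr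
      _ = _ := mul_one _
  · rw [Valuation.map_mul, mul_assoc, hX, mul_one]
    exact hμa

/-- **CLEAN READING OF THE RAY SCALAR**: under §2's size letters with `d ≤ b`, `2b + m* ≤ n` (`m* = mstarOfRecord d = d%2 + 2d − 1`) and the CLEAN boundary digit
`|μ_b·τ| ≤ |ϖ|^{m*}`: `|(μ_a pw + μ_b τ)·t⁻¹ − e| ≤ |ϖ|^{2d−1}`, `e = f·h_W·N(ϖ^b g₁)`. [cite: Serre1979, Ch. V §3 Cor. 3] [cite: Jacobowitz1962, §4] [cite: Rogawski1990, §4.9 Prop. 4.9.1 (b) p. 55] -/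
theorem v_rayScalar_sub_le_of_clean (σ : E →+* E) (hvσ : ∀ a, Valued.v (σ a) = Valued.v a) {ϖ : E} (hϖ : Valued.v ϖ = exp (-1 : ℤ))
    {pw g₁ hW f t τ μa μb : E} {b d n : ℕ} (hint : Valued.v (pw + σ g₁ * hW * g₁) ≤ 1) (hu : Valued.v (ϖ ^ b * g₁) = 1) (hh : Valued.v hW = 1)
    (hf1 : Valued.v f ≤ 1) (ht : Valued.v t = Valued.v ϖ ^ (d % 2))
    (hμa : Valued.v (μa + f * t * (ϖ * σ ϖ) ^ b) ≤ Valued.v ϖ ^ n) (hn : 2 * b + mstarOfRecord d ≤ n) (hdb : d ≤ b) (hd1 : 1 ≤ d)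
    (hclean : Valued.v (μb * τ) ≤ Valued.v ϖ ^ mstarOfRecord d) :
    Valued.v ((μa * pw + μb * τ) * t⁻¹ - f * hW * ((ϖ ^ b * g₁) * σ (ϖ ^ b * g₁))) ≤ Valued.v ϖ ^ (2 * d - 1) := by
  have hvϖ0 : Valued.v ϖ ≠ 0 := by rw [hϖ]; exact exp_ne_zero
  have hϖ1 : Valued.v ϖ ≤ 1 := by rw [hϖ, ← exp_zero, exp_le_exp]; norm_num
  have hm : mstarOfRecord d = d % 2 + 2 * d - 1 := rfl
  have ht0 : t ≠ 0 := fun h0 => by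
    rw [h0, map_zero] at ht; exact pow_ne_zero _ hvϖ0 ht.symm
  have hvt0 : Valued.v t ≠ 0 := (Valuation.ne_zero_iff _).2 ht0
  obtain ⟨h1, h2⟩ := v_errors_le σ hvσ hϖ hint hu hh hf1 ht hμa (by rw [hm] at hn; omega)
  -- the numerator is `≤ |ϖ|^{m*}`
  have hnum : Valued.v (μa * pw + μb * τ - t * (f * hW * ((ϖ ^ b * g₁) * σ (ϖ ^ b * g₁)))) ≤ Valued.v ϖ ^ mstarOfRecord d := by
    rw [main_sub_eq σ ϖ f hW g₁ t pw τ μa μb b]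
    refine (Valuation.map_add _ _ _).trans (max_le ((Valuation.map_sub _ _ _).trans (max_le ?_ ?_)) hclean)
    · exact h1.trans (pow_le_pow_right_of_le_one' hϖ1 (by rw [hm]; omega))
    · -- `|(μ_a + f t P)·X| ≤ |ϖ|^{n − 2b} ≤ |ϖ|^{m*}`
      have hP0 : Valued.v ϖ ^ (2 * b) ≠ 0 := pow_ne_zero _ hvϖ0
      have h2' : Valued.v ((μa + f * t * (ϖ * σ ϖ) ^ b) * (σ g₁ * hW * g₁)) ≤ Valued.v ϖ ^ n * (Valued.v ϖ ^ (2 * b))⁻¹ :=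
        (le_mul_inv_iff₀ (zero_lt_iff.2 hP0)).2 h2
      refine h2'.trans ?_
      rw [show n = (n - 2 * b) + 2 * b by omega, pow_add, mul_inv_cancel_right₀ hP0]
      exact pow_le_pow_right_of_le_one' hϖ1 (by rw [hm]; omega)
  -- divide by `t`
  have e : (μa * pw + μb * τ) * t⁻¹ - f * hW * ((ϖ ^ b * g₁) * σ (ϖ ^ b * g₁)) =
      t⁻¹ * (μa * pw + μb * τ - t * (f * hW * ((ϖ ^ b * g₁) * σ (ϖ ^ b * g₁)))) := by field_simp
  rw [e, Valuation.map_mul, map_inv₀, ht, inv_mul_le_iff₀ (zero_lt_iff.2 (pow_ne_zero _ hvϖ0)), ← pow_add]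
  refine hnum.trans (le_of_eq ?_)
  rw [hm]; congr 1; omega

/-- **FLIP READING OF THE RAY SCALAR**: under §2's size letters with `d ≤ b`, `2b + m* ≤ n` and the FLIP DIGIT `|μ_b·τ| = |ϖ|^{2(d−1) + d%2}` EXACTLY, `|(μ_a pw + μ_b τ)·t⁻¹ − e| = |ϖ|^{2(d−1)}`
EXACTLY (both error terms strictly below the boundary digit). [cite: Serre1979, Ch. V §3 Cor. 3] [cite: Jacobowitz1962, §4] [cite: Rogawski1990, §4.9 Prop. 4.9.1 (b) p. 55] -/
theorem v_rayScalar_sub_eq_of_flip (σ : E →+* E) (hvσ : ∀ a, Valued.v (σ a) = Valued.v a) {ϖ : E} (hϖ : Valued.v ϖ = exp (-1 : ℤ))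
    {pw g₁ hW f t τ μa μb : E} {b d n : ℕ} (hint : Valued.v (pw + σ g₁ * hW * g₁) ≤ 1) (hu : Valued.v (ϖ ^ b * g₁) = 1) (hh : Valued.v hW = 1)
    (hf1 : Valued.v f ≤ 1) (ht : Valued.v t = Valued.v ϖ ^ (d % 2))
    (hμa : Valued.v (μa + f * t * (ϖ * σ ϖ) ^ b) ≤ Valued.v ϖ ^ n) (hn : 2 * b + mstarOfRecord d ≤ n) (hdb : d ≤ b) (hd1 : 1 ≤ d)
    (hflip : Valued.v (μb * τ) = Valued.v ϖ ^ (2 * (d - 1) + d % 2)) :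
    Valued.v ((μa * pw + μb * τ) * t⁻¹ - f * hW * ((ϖ ^ b * g₁) * σ (ϖ ^ b * g₁))) = Valued.v ϖ ^ (2 * (d - 1)) := by
  have hvϖ0 : Valued.v ϖ ≠ 0 := by rw [hϖ]; exact exp_ne_zero
  have hϖlt : Valued.v ϖ < 1 := by rw [hϖ, ← exp_zero, exp_lt_exp]; norm_num
  have hm : mstarOfRecord d = d % 2 + 2 * d - 1 := rfl
  have ht0 : t ≠ 0 := fun h0 => by
    rw [h0, map_zero] at ht; exact pow_ne_zero _ hvϖ0 ht.symm
  obtain ⟨h1, h2⟩ := v_errors_le σ hvσ hϖ hint hu hh hf1 ht hμa (by rw [hm] at hn; omega)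
  have hpos : (0 : ℤᵐ⁰) < Valued.v ϖ := zero_lt_iff.2 hvϖ0
  -- both error terms are STRICTLY below the flip digit
  have h1lt : Valued.v (μa * (pw + σ g₁ * hW * g₁)) < Valued.v (μb * τ) := by
    rw [hflip]
    exact lt_of_le_of_lt h1 (pow_lt_pow_right_of_lt_one₀ hpos hϖlt (by omega))
  have h2lt : Valued.v ((μa + f * t * (ϖ * σ ϖ) ^ b) * (σ g₁ * hW * g₁)) < Valued.v (μb * τ) := by
    have hP0 : Valued.v ϖ ^ (2 * b) ≠ 0 := pow_ne_zero _ hvϖ0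
    have h2' : Valued.v ((μa + f * t * (ϖ * σ ϖ) ^ b) * (σ g₁ * hW * g₁)) ≤ Valued.v ϖ ^ n * (Valued.v ϖ ^ (2 * b))⁻¹ :=
      (le_mul_inv_iff₀ (zero_lt_iff.2 hP0)).2 h2
    rw [hflip]
    refine lt_of_le_of_lt h2' ?_
    rw [show n = (n - 2 * b) + 2 * b by omega, pow_add, mul_inv_cancel_right₀ hP0]
    exact pow_lt_pow_right_of_lt_one₀ hpos hϖlt (by rw [hm] at hn; omega)
  have hnum : Valued.v (μa * pw + μb * τ - t * (f * hW * ((ϖ ^ b * g₁) * σ (ϖ ^ b * g₁)))) = Valued.v ϖ ^ (2 * (d - 1) + d % 2) := by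
    rw [main_sub_eq σ ϖ f hW g₁ t pw τ μa μb b, ← hflip]
    have hsub : Valued.v (μa * (pw + σ g₁ * hW * g₁) - (μa + f * t * (ϖ * σ ϖ) ^ b) * (σ g₁ * hW * g₁)) < Valued.v (μb * τ) :=
      lt_of_le_of_lt (Valuation.map_sub _ _ _) (max_lt h1lt h2lt)
    rw [Valuation.map_add_eq_of_lt_right _ hsub]
  have e : (μa * pw + μb * τ) * t⁻¹ - f * hW * ((ϖ ^ b * g₁) * σ (ϖ ^ b * g₁)) =
      t⁻¹ * (μa * pw + μb * τ - t * (f * hW * ((ϖ ^ b * g₁) * σ (ϖ ^ b * g₁)))) := by field_simp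
  rw [e, Valuation.map_mul, map_inv₀, ht, hnum, pow_add, mul_comm (Valued.v ϖ ^ (2 * (d - 1))), ← mul_assoc,
    inv_mul_cancel₀ (pow_ne_zero _ hvϖ0), one_mul]

/-! ## §3 The digit of the boundary scalar across `jE`: `|μ_b·τ|` from the dictionary equations `hk` and `hflip` ∕ `hclean` -/

/-- **THE FLIP DIGIT IN `E`**: `jE τ = Tr_ρ(α·D₀⁻¹)`, `hk : |Tr_ρ D₀⁻¹| < |D₀⁻¹|·|α − ρα|` (so `|jE τ| = |D₀|⁻¹·|α − ρα|` EXACTLY, ★ `v_gen_mul_add_map_eq_of_lt`) and the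
dictionary equation `|jE μ_b|·|D₀|⁻¹·|α − ρα| = |jEϖ|^k` give `|μ_b·τ| = |ϖ|^k`. [cite: Serre1979, Ch. III §6 Prop. 12] [cite: Serre1979, Ch. V §3 Cor. 3] -/
theorem v_boundaryScalar_eq_of_flip (jE : E →+* M) (hjv : ∀ c, Valued.v (jE c) ≤ 1 ↔ Valued.v c ≤ 1) (hvρ : ∀ x, Valued.v (ρ x) = Valued.v x)
    (hα1 : Valued.v α ≤ 1) {ϖ : E} (hϖ0 : ϖ ≠ 0) {D₀ : M} {τ μb : E} (hτ : α * D₀⁻¹ + ρ (α * D₀⁻¹) = jE τ)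
    (hk : Valued.v (D₀⁻¹ + ρ D₀⁻¹) < Valued.v D₀⁻¹ * Valued.v (α - ρ α)) {k : ℕ}
    (hflip : Valued.v (jE μb) * (Valued.v D₀)⁻¹ * Valued.v (α - ρ α) = Valued.v (jE ϖ) ^ k) :
    Valued.v (μb * τ) = Valued.v ϖ ^ k := by
  refine v_eq_pow_of_map_eq jE hjv hϖ0 ?_
  rw [map_mul, Valuation.map_mul, ← hτ, v_gen_mul_add_map_eq_of_lt hvρ hα1 hk, map_inv₀, ← mul_assoc, hflip]

/-- **THE CLEAN DIGIT IN `E`** (no `hk`): `|jE μ_b|·max(|Tr_ρ D₀⁻¹|, |D₀|⁻¹·|α − ρα|) ≤ |jEϖ|^k` gives `|μ_b·τ| ≤ |ϖ|^k` (★ `v_gen_mul_add_map_le`). [cite: Serre1979, Ch. III §6 Prop. 12] -/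
theorem v_boundaryScalar_le_of_clean (jE : E →+* M) (hjv : ∀ c, Valued.v (jE c) ≤ 1 ↔ Valued.v c ≤ 1) (hvρ : ∀ x, Valued.v (ρ x) = Valued.v x)
    (hα1 : Valued.v α ≤ 1) {ϖ : E} (hϖ0 : ϖ ≠ 0) {D₀ : M} {τ μb : E} (hτ : α * D₀⁻¹ + ρ (α * D₀⁻¹) = jE τ) {k : ℕ}
    (hclean : Valued.v (jE μb) * max (Valued.v (D₀⁻¹ + ρ D₀⁻¹)) ((Valued.v D₀)⁻¹ * Valued.v (α - ρ α)) ≤ Valued.v (jE ϖ) ^ k) :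
    Valued.v (μb * τ) ≤ Valued.v ϖ ^ k := by
  refine (v_map_le_pow_iff jE hjv hϖ0 _ k).1 ?_
  rw [map_mul, Valuation.map_mul, ← hτ]
  refine le_trans (mul_le_mul' le_rfl ?_) hclean
  have h := v_gen_mul_add_map_le hvρ hα1 D₀⁻¹
  have hinv : Valued.v D₀⁻¹ = (Valued.v D₀)⁻¹ := map_inv₀ _ D₀
  rwa [hinv] at h

/-! ## §4 HEADS — the census letter of an integral glued vertex over a ray-dominated cell: CLEAN `e • X₊`, FLIP `(c·e) • X₊` -/

/-- **HEAD′ — «THE CLEAN READING WITHOUT `hlam`».**  ★ p861810 HEAD's frame (= ★ p861372 HEAD B's: plane `(E², H₂)`, block form `block(H₂, h_W)`, UNIT line entry `h_W`,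
`Γ = endoGL (γ₂, u)`, `|u₀₀ − 1| ≤ |ϖ^{m*}|`, ★ (C1)'s line model, an integral vertex `L` glued over `(B₂, w₀)` with generator `g₀`, `Λ = x₀·𝒪_cc`, `φ w₀ = Y⁻¹x₀`) + the ray-domination
letters of ★ p861653 at `m*` + the sheet datum on `E` + (instead of `hlam`) `lam − jE u₀₀ = jE μ_a + jE μ_b·α`, the clean `E`-letter `|μ_a + f·t₊·(ϖσϖ)^b| ≤ |ϖ|^n` (`|f| = 1`,
`2b + m* ≤ n`, `d ≤ b`) and the CLEAN dictionary letter `|jE μ_b|·max(|Tr_ρ D₀⁻¹|, |D₀|⁻¹·|α − ρα|) ≤ |jEϖ|^{m*}` ⟹ the `ϖ^{m*}`-value set of `Γ − 1` on `L` is `valueSetMod σ ϖ m* (e • X₊)`,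
`e = f·h_W·N(ϖ^b·g₀ 1)`. [cite: Jacobowitz1962, §4] [cite: Rogawski1990, §4.9 Prop. 4.9.1 (b) p. 55] [cite: Kottwitz1986BaseChangeUnits, §1 pp. 240–241] [cite: Serre1979, Ch. V §3 Cor. 3] -/
theorem valueSet_endoGL_sub_one_glued_eq_smul_xPlus_of_clean {σ : E →+* E} {ϖ : E} {d t : ℕ} (hD : IsRamifiedQuadraticDatum σ ϖ d t)
    (H₂ : Matrix (Fin 2) (Fin 2) E) {h : E} (hh1 : Valued.v h = 1)
    (jE : E →+* M) (hjv : ∀ c, Valued.v (jE c) ≤ 1 ↔ Valued.v c ≤ 1) (hjfix : ∀ z, ρ z = z ↔ ∃ c, jE c = z)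
    (hρρ : ∀ x, ρ (ρ x) = x) (hvρ : ∀ x, Valued.v (ρ x) = Valued.v x) (hα : ρ α ≠ α) (hα1 : Valued.v α ≤ 1)
    (hintρ : ∀ z : M, Valued.v z ≤ 1 → Valued.v ((z - ρ z) / (α - ρ α)) ≤ 1)
    (hΘΘ : ∀ x, Θ (Θ x) = x) (hΘρ : ∀ x, Θ (ρ x) = ρ (Θ x)) (hvΘ : ∀ x, Valued.v (Θ x) = Valued.v x) (hΘj : ∀ c, Θ (jE c) = jE (σ c))
    (φ : (Fin 2 → E) →+ M) (hφs : ∀ (c : E) (x : Fin 2 → E), φ (c • x) = jE c * φ x)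
    {γ₂ : GL (Fin 2) E} {lam hM : M} (hφγ : ∀ x, φ ((γ₂ : Matrix (Fin 2) (Fin 2) E) *ᵥ x) = lam * φ x) (hhM : hM ≠ 0) (hΘh : Θ hM = hM)
    (hform : ∀ x y, jE (pairing σ H₂ x y) = hM * Θ (φ x) * φ y + ρ (hM * Θ (φ x) * φ y))
    {L : Submodule 𝒪[E] (Fin 3 → E)} {b : ℕ} (hpr : ∀ x ∈ L, Valued.v (x 1) * Valued.v ϖ ^ b ≤ 1)
    (hint : ∀ y ∈ L, Valued.v (pairing σ (!![H₂ 0 0, 0, H₂ 0 1; 0, h, 0; H₂ 1 0, 0, H₂ 1 1] : Matrix (Fin 3) (Fin 3) E) y y) ≤ 1)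
    {B₂ : Submodule 𝒪[E] (Fin 2 → E)} {w₀ : Fin 2 → E} {g₀ : Fin 3 → E}
    (hB : B₂.map ((Matrix.toLin' (!![1, 0; 0, 0; 0, 1] : Matrix (Fin 3) (Fin 2) E)).restrictScalars 𝒪[E]) =
      L ⊓ LinearMap.ker ((LinearMap.proj (1 : Fin 3) : (Fin 3 → E) →ₗ[E] E).restrictScalars 𝒪[E]))
    (hg₀ : g₀ ∈ L) (hg₀1 : Valued.v (g₀ 1) * Valued.v ϖ ^ b = 1) (hprg : g₀ - Pi.single 1 (g₀ 1) = ![w₀ 0, 0, w₀ 1])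
    (u : GL (Fin 1) E) (hum : Valued.v ((u : Matrix (Fin 1) (Fin 1) E) 0 0 - 1) ≤ Valued.v (ϖ ^ mstarOfRecord d))
    {cc x₀ : M} (hc : ρ cc = cc) (hc0 : cc ≠ 0) (hc1 : Valued.v cc ≤ 1) (hcc : cc * (α - ρ α) ≠ 0) (hx₀ : x₀ ≠ 0)
    {Λ : AddSubgroup M} (hBΛ : B₂.toAddSubgroup.map φ = Λ)
    (hΛx : ∀ x, x ∈ Λ ↔ ∃ ζ, IsOrd ρ α cc ζ ∧ x = x₀ * ζ) (hw₀Y : φ w₀ = (dualGen ρ Θ α cc hM x₀)⁻¹ * x₀)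
    -- the ray-domination letters (★ p861653) at the modulus `m*`
    (hYO : IsOrd ρ α cc (dualGen ρ Θ α cc hM x₀))
    {μt : M} {m' : ℕ} (hμ : lam - jE ((u : Matrix (Fin 1) (Fin 1) E) 0 0) = jE (ϖ ^ m') * μt) (hμt : IsOrd ρ α cc μt) (hmm : mstarOfRecord d ≤ m')
    -- the `E`-decomposition of the depth multiplier, the clean `E`-letter, the CLEAN dictionary letter
    {μa μb : E} (hμab : lam - jE ((u : Matrix (Fin 1) (Fin 1) E) 0 0) = jE μa + jE μb * α)
    {f : E} (hf1 : Valued.v f = 1) {n : ℕ}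
    (hμa : Valued.v (μa + f * ((ϖ - σ ϖ) * ((ϖ * σ ϖ) ^ ((d - d % 2) / 2))⁻¹) * (ϖ * σ ϖ) ^ b) ≤ Valued.v ϖ ^ n)
    (hn : 2 * b + mstarOfRecord d ≤ n) (hdb : d ≤ b)
    (hclean : Valued.v (jE μb) * max (Valued.v ((cc * (α - ρ α) * Θ (dualGen ρ Θ α cc hM x₀))⁻¹ + ρ (cc * (α - ρ α) * Θ (dualGen ρ Θ α cc hM x₀))⁻¹))
        ((Valued.v (cc * (α - ρ α) * Θ (dualGen ρ Θ α cc hM x₀)))⁻¹ * Valued.v (α - ρ α)) ≤ Valued.v (jE ϖ) ^ mstarOfRecord d) :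
    {z : E | ∃ y ∈ L, Valued.v ((ϖ ^ mstarOfRecord d)⁻¹ * (z - pairing σ (!![H₂ 0 0, 0, H₂ 0 1; 0, h, 0; H₂ 1 0, 0, H₂ 1 1] : Matrix (Fin 3) (Fin 3) E) y
        ((((endoGL (γ₂, u) : GL (Fin 3) E) : Matrix (Fin 3) (Fin 3) E) - 1) *ᵥ y))) ≤ 1} =
      valueSetMod σ ϖ (mstarOfRecord d) ((f * h * ((ϖ ^ b * g₀ 1) * σ (ϖ ^ b * g₀ 1))) • xPlus σ ϖ d) := by
  obtain ⟨hσσ, hvσ, hϖ, -, hd, hd1, -⟩ := id hD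
  rw [valueSet_endoGL_sub_one_glued_eq_normFormSet_of_gen σ hϖ H₂ h jE hjv hΘΘ φ hφs hφγ hhM hform hpr hint hB hg₀ hg₀1 hprg u (mstarOfRecord d) hum hcc hx₀ hBΛ hΛx hw₀Y]
  -- names
  set Y : M := dualGen ρ Θ α cc hM x₀ with hYdef
  set D₀ : M := cc * (α - ρ α) * Θ Y with hD₀def
  have hvϖ0 : Valued.v ϖ ≠ 0 := by rw [hϖ]; exact exp_ne_zero
  have hϖ0 : ϖ ≠ 0 := fun h0 => by rw [h0, map_zero] at hvϖ0; exact hvϖ0 rfl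
  have hρj : ∀ c : E, ρ (jE c) = jE c := fun c => (hjfix _).2 ⟨c, rfl⟩
  -- the glue letters: `Tr_ρ(D₀⁻¹) = jE⟨w₀,w₀⟩`, integrality of `g₀`, the unit `ϖ^b·g₀ 1`
  have hTr : D₀⁻¹ + ρ D₀⁻¹ = jE (pairing σ H₂ w₀ w₀) := inv_add_map_inv_eq_map_pairing σ H₂ jE hΘΘ φ hhM hform hcc hx₀ hw₀Y
  have hw₀g : (![g₀ 0, g₀ 2] : Fin 2 → E) = w₀ := by
    have h0 := congrFun hprg 0
    have h2 := congrFun hprg 2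
    simp only [Pi.sub_apply, Pi.single_apply] at h0 h2
    ext i; fin_cases i <;> simp_all
  have hintg : Valued.v (pairing σ H₂ w₀ w₀ + σ (g₀ 1) * h * g₀ 1) ≤ 1 := by
    have h1 := hint g₀ hg₀
    rwa [pairing_self_eq_plane_add_line σ H₂ h g₀, hw₀g] at h1
  have hu₀ : Valued.v (ϖ ^ b * g₀ 1) = 1 := by rw [Valuation.map_mul, Valuation.map_pow, mul_comm]; exact hg₀1
  -- the boundary scalar `τ ∈ E` and the ray scalar `e₀′ = μ_a·pw + μ_b·τ`
  obtain ⟨τ, hτ⟩ := (hjfix (α * D₀⁻¹ + ρ (α * D₀⁻¹))).1 (by rw [map_add, hρρ, add_comm])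
  have he₀ : jE (μa * pairing σ H₂ w₀ w₀ + μb * τ) =
      (lam - jE ((u : Matrix (Fin 1) (Fin 1) E) 0 0)) / D₀ + ρ ((lam - jE ((u : Matrix (Fin 1) (Fin 1) E) 0 0)) / D₀) := by
    rw [hμab, trace_div_eq_main_add_boundary jE hρj D₀ hTr μa μb, ← hτ, map_add, map_mul jE μb τ]
  -- HEAD B's `μ·N∕D₀` is ★ p861653's `μ∕D₀·N`
  simp_rw [mul_div_right_comm (lam - jE ((u : Matrix (Fin 1) (Fin 1) E) 0 0))]
  rw [normFormSet_eq_ray_of_isOrd hρρ hvρ hα hα1 hintρ hΘΘ hΘρ hvΘ hc hc0 hc1 hcc hhM hΘh hx₀ hΛx hYO hvσ hϖ hd jE hjv hΘj hjfix hμ hμt hmm he₀]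
  -- the CLEAN reading: `|g − e| ≤ |ϖ|^{2d−1}`, and (S0″) at `m* ≤ (2d − 1) + d%2`
  have hτle : Valued.v (μb * τ) ≤ Valued.v ϖ ^ mstarOfRecord d :=
    v_boundaryScalar_le_of_clean jE hjv hvρ hα1 hϖ0 hτ.symm hclean
  have hge := v_rayScalar_sub_le_of_clean σ hvσ hϖ hintg hu₀ hh1 hf1.le (v_refSkew_eq hvσ hϖ hd) hμa hn hdb hd1 hτle
  exact valueSetMod_smul_xPlus_eq_of_v_sub_le_pred hvσ hϖ hd (show mstarOfRecord d ≤ (2 * d - 1) + d % 2 from by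
    show d % 2 + 2 * d - 1 ≤ _; omega) hge

/-- **HEAD — «THE LETTER OF A RAY VERTEX AT THE FLIP DIGIT IS `(c·e) • X₊`» (`q = 2`).**  HEAD′'s frame with `E` complete, `#𝓀[E] = 2`, `|2| < 1`, `h_W` and `f` `σ`-fixed units,
and, instead of the clean letter, the cell's DICTIONARY EQUATIONS `hk : |Tr_ρ D₀⁻¹| < |D₀⁻¹|·|α − ρα|` (★ `hk_of_lt`) and `hflip : |jE μ_b|·|D₀|⁻¹·|α − ρα| = |jEϖ|^{2(d−1) + d%2}`
(RamM `K₀` at `δ = 2d`) ⟹ for EVERY `σ`-fixed non-norm unit `c` the `ϖ^{m*}`-value set of `Γ − 1` on `L` is `valueSetMod σ ϖ m* ((c·e) • X₊)`, `e = f·h_W·N(ϖ^b·g₀ 1)`: the `c`-TWIST of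
HEAD′'s letter ((κ-b) «`K₀ = −D`» per vertex, any parity of `d`). [cite: Serre1979, Ch. V §3 Prop. 5, Cor. 2–3; Ch. XV §2] [cite: Jacobowitz1962, §4] [cite: Rogawski1990, §4.9 Prop. 4.9.1 (b) p. 55]
[cite: Kottwitz1986BaseChangeUnits, §1 pp. 240–241] [cite: LanglandsShelstad1987, §1–§3] -/
theorem valueSet_endoGL_sub_one_glued_eq_twist_smul_xPlus_of_flip [CompleteSpace E] [Fintype 𝓀[E]]
    {σ : E →+* E} {ϖ : E} {d t : ℕ} (hD : IsRamifiedQuadraticDatum σ ϖ d t) (h2v : Valued.v (2 : E) < 1) (hq : Fintype.card 𝓀[E] = 2)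
    (H₂ : Matrix (Fin 2) (Fin 2) E) {h : E} (hσh : σ h = h) (hh1 : Valued.v h = 1)
    (jE : E →+* M) (hjv : ∀ c, Valued.v (jE c) ≤ 1 ↔ Valued.v c ≤ 1) (hjfix : ∀ z, ρ z = z ↔ ∃ c, jE c = z)
    (hρρ : ∀ x, ρ (ρ x) = x) (hvρ : ∀ x, Valued.v (ρ x) = Valued.v x) (hα : ρ α ≠ α) (hα1 : Valued.v α ≤ 1)
    (hintρ : ∀ z : M, Valued.v z ≤ 1 → Valued.v ((z - ρ z) / (α - ρ α)) ≤ 1)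
    (hΘΘ : ∀ x, Θ (Θ x) = x) (hΘρ : ∀ x, Θ (ρ x) = ρ (Θ x)) (hvΘ : ∀ x, Valued.v (Θ x) = Valued.v x) (hΘj : ∀ c, Θ (jE c) = jE (σ c))
    (φ : (Fin 2 → E) →+ M) (hφs : ∀ (c : E) (x : Fin 2 → E), φ (c • x) = jE c * φ x)
    {γ₂ : GL (Fin 2) E} {lam hM : M} (hφγ : ∀ x, φ ((γ₂ : Matrix (Fin 2) (Fin 2) E) *ᵥ x) = lam * φ x) (hhM : hM ≠ 0) (hΘh : Θ hM = hM)
    (hform : ∀ x y, jE (pairing σ H₂ x y) = hM * Θ (φ x) * φ y + ρ (hM * Θ (φ x) * φ y))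
    {L : Submodule 𝒪[E] (Fin 3 → E)} {b : ℕ} (hpr : ∀ x ∈ L, Valued.v (x 1) * Valued.v ϖ ^ b ≤ 1)
    (hint : ∀ y ∈ L, Valued.v (pairing σ (!![H₂ 0 0, 0, H₂ 0 1; 0, h, 0; H₂ 1 0, 0, H₂ 1 1] : Matrix (Fin 3) (Fin 3) E) y y) ≤ 1)
    {B₂ : Submodule 𝒪[E] (Fin 2 → E)} {w₀ : Fin 2 → E} {g₀ : Fin 3 → E}
    (hB : B₂.map ((Matrix.toLin' (!![1, 0; 0, 0; 0, 1] : Matrix (Fin 3) (Fin 2) E)).restrictScalars 𝒪[E]) =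
      L ⊓ LinearMap.ker ((LinearMap.proj (1 : Fin 3) : (Fin 3 → E) →ₗ[E] E).restrictScalars 𝒪[E]))
    (hg₀ : g₀ ∈ L) (hg₀1 : Valued.v (g₀ 1) * Valued.v ϖ ^ b = 1) (hprg : g₀ - Pi.single 1 (g₀ 1) = ![w₀ 0, 0, w₀ 1])
    (u : GL (Fin 1) E) (hum : Valued.v ((u : Matrix (Fin 1) (Fin 1) E) 0 0 - 1) ≤ Valued.v (ϖ ^ mstarOfRecord d))
    {cc x₀ : M} (hc : ρ cc = cc) (hc0 : cc ≠ 0) (hc1 : Valued.v cc ≤ 1) (hcc : cc * (α - ρ α) ≠ 0) (hx₀ : x₀ ≠ 0)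
    {Λ : AddSubgroup M} (hBΛ : B₂.toAddSubgroup.map φ = Λ)
    (hΛx : ∀ x, x ∈ Λ ↔ ∃ ζ, IsOrd ρ α cc ζ ∧ x = x₀ * ζ) (hw₀Y : φ w₀ = (dualGen ρ Θ α cc hM x₀)⁻¹ * x₀)
    -- the ray-domination letters (★ p861653) at the modulus `m*`
    (hYO : IsOrd ρ α cc (dualGen ρ Θ α cc hM x₀))
    {μt : M} {m' : ℕ} (hμ : lam - jE ((u : Matrix (Fin 1) (Fin 1) E) 0 0) = jE (ϖ ^ m') * μt) (hμt : IsOrd ρ α cc μt) (hmm : mstarOfRecord d ≤ m')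
    -- the `E`-decomposition of the depth multiplier and the clean `E`-letter
    {μa μb : E} (hμab : lam - jE ((u : Matrix (Fin 1) (Fin 1) E) 0 0) = jE μa + jE μb * α)
    {f : E} (hσf : σ f = f) (hf1 : Valued.v f = 1) {n : ℕ}
    (hμa : Valued.v (μa + f * ((ϖ - σ ϖ) * ((ϖ * σ ϖ) ^ ((d - d % 2) / 2))⁻¹) * (ϖ * σ ϖ) ^ b) ≤ Valued.v ϖ ^ n)
    (hn : 2 * b + mstarOfRecord d ≤ n) (hdb : d ≤ b)
    -- the two dictionary equations of the cell: `hk` and the FLIP DIGIT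
    (hk : Valued.v ((cc * (α - ρ α) * Θ (dualGen ρ Θ α cc hM x₀))⁻¹ + ρ (cc * (α - ρ α) * Θ (dualGen ρ Θ α cc hM x₀))⁻¹) <
      Valued.v (cc * (α - ρ α) * Θ (dualGen ρ Θ α cc hM x₀))⁻¹ * Valued.v (α - ρ α))
    (hflip : Valued.v (jE μb) * (Valued.v (cc * (α - ρ α) * Θ (dualGen ρ Θ α cc hM x₀)))⁻¹ * Valued.v (α - ρ α) =
      Valued.v (jE ϖ) ^ (2 * (d - 1) + d % 2))
    {c : E} (hσc : σ c = c) (hcu : Valued.v c = 1) (hcN : ¬ ∃ z : E, z * σ z = c) :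
    {z : E | ∃ y ∈ L, Valued.v ((ϖ ^ mstarOfRecord d)⁻¹ * (z - pairing σ (!![H₂ 0 0, 0, H₂ 0 1; 0, h, 0; H₂ 1 0, 0, H₂ 1 1] : Matrix (Fin 3) (Fin 3) E) y
        ((((endoGL (γ₂, u) : GL (Fin 3) E) : Matrix (Fin 3) (Fin 3) E) - 1) *ᵥ y))) ≤ 1} =
      valueSetMod σ ϖ (mstarOfRecord d) ((c * (f * h * ((ϖ ^ b * g₀ 1) * σ (ϖ ^ b * g₀ 1)))) • xPlus σ ϖ d) := by
  obtain ⟨hσσ, hvσ, hϖ, -, hd, hd1, -⟩ := id hD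
  rw [valueSet_endoGL_sub_one_glued_eq_normFormSet_of_gen σ hϖ H₂ h jE hjv hΘΘ φ hφs hφγ hhM hform hpr hint hB hg₀ hg₀1 hprg u (mstarOfRecord d) hum hcc hx₀ hBΛ hΛx hw₀Y]
  -- names
  set Y : M := dualGen ρ Θ α cc hM x₀ with hYdef
  set D₀ : M := cc * (α - ρ α) * Θ Y with hD₀def
  have hvϖ0 : Valued.v ϖ ≠ 0 := by rw [hϖ]; exact exp_ne_zero
  have hϖ0 : ϖ ≠ 0 := fun h0 => by rw [h0, map_zero] at hvϖ0; exact hvϖ0 rfl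
  have hρj : ∀ c : E, ρ (jE c) = jE c := fun c => (hjfix _).2 ⟨c, rfl⟩
  -- the glue letters
  have hTr : D₀⁻¹ + ρ D₀⁻¹ = jE (pairing σ H₂ w₀ w₀) := inv_add_map_inv_eq_map_pairing σ H₂ jE hΘΘ φ hhM hform hcc hx₀ hw₀Y
  have hw₀g : (![g₀ 0, g₀ 2] : Fin 2 → E) = w₀ := by
    have h0 := congrFun hprg 0
    have h2 := congrFun hprg 2
    simp only [Pi.sub_apply, Pi.single_apply] at h0 h2
    ext i; fin_cases i <;> simp_all
  have hintg : Valued.v (pairing σ H₂ w₀ w₀ + σ (g₀ 1) * h * g₀ 1) ≤ 1 := by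
    have h1 := hint g₀ hg₀
    rwa [pairing_self_eq_plane_add_line σ H₂ h g₀, hw₀g] at h1
  have hu₀ : Valued.v (ϖ ^ b * g₀ 1) = 1 := by rw [Valuation.map_mul, Valuation.map_pow, mul_comm]; exact hg₀1
  -- the boundary scalar `τ ∈ E` and the ray scalar `e₀′ = μ_a·pw + μ_b·τ`
  obtain ⟨τ, hτ⟩ := (hjfix (α * D₀⁻¹ + ρ (α * D₀⁻¹))).1 (by rw [map_add, hρρ, add_comm])
  have he₀ : jE (μa * pairing σ H₂ w₀ w₀ + μb * τ) =
      (lam - jE ((u : Matrix (Fin 1) (Fin 1) E) 0 0)) / D₀ + ρ ((lam - jE ((u : Matrix (Fin 1) (Fin 1) E) 0 0)) / D₀) := by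
    rw [hμab, trace_div_eq_main_add_boundary jE hρj D₀ hTr μa μb, ← hτ, map_add, map_mul jE μb τ]
  simp_rw [mul_div_right_comm (lam - jE ((u : Matrix (Fin 1) (Fin 1) E) 0 0))]
  rw [normFormSet_eq_ray_of_isOrd hρρ hvρ hα hα1 hintρ hΘΘ hΘρ hvΘ hc hc0 hc1 hcc hhM hΘh hx₀ hΛx hYO hvσ hϖ hd jE hjv hΘj hjfix hμ hμt hmm he₀]
  -- the FLIP reading: `|g − e| = |ϖ|^{2(d−1)}` exactly
  have hτeq : Valued.v (μb * τ) = Valued.v ϖ ^ (2 * (d - 1) + d % 2) :=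
    v_boundaryScalar_eq_of_flip jE hjv hvρ hα1 hϖ0 hτ.symm hk hflip
  have hge := v_rayScalar_sub_eq_of_flip σ hvσ hϖ hintg hu₀ hh1 hf1.le (v_refSkew_eq hvσ hϖ hd) hμa hn hdb hd1 hτeq
  -- `e = f·h_W·N(ϖ^b g₀ 1)` is a `σ`-fixed unit
  have hσe : σ (f * h * ((ϖ ^ b * g₀ 1) * σ (ϖ ^ b * g₀ 1))) = f * h * ((ϖ ^ b * g₀ 1) * σ (ϖ ^ b * g₀ 1)) := by
    rw [map_mul, map_mul, map_mul, hσf, hσh, hσσ, mul_comm (σ (ϖ ^ b * g₀ 1)) (ϖ ^ b * g₀ 1)]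
  have he1 : Valued.v (f * h * ((ϖ ^ b * g₀ 1) * σ (ϖ ^ b * g₀ 1))) = 1 := by
    simp only [Valuation.map_mul, hvσ (ϖ ^ b * g₀ 1), hf1, hh1, hu₀, mul_one]
  exact valueSetMod_smul_xPlus_eq_twist_of_v_sub_eq_shell' hD h2v hq hσe he1 hge hσc hcu hcN

/-! ## §5 The label corollaries: the flipped vertex is `+` iff `f·h_W ∉ N(E^×)`, the clean one iff `f·h_W ∈ N(E^×)` -/

/-- **THE LABEL OF THE CLEAN VERTEX** (★ p861154's dictionary + «a norm factor does not move the class»): a letter `S = valueSetMod σ ϖ m* (e • X₊)`, `e = f·h_W·N(u₀)` with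
`f`, `h_W` `σ`-fixed units and `u₀` a unit, is `+` iff `f·h_W ∈ N(E^×)`. [cite: Serre1979, Ch. V §3 Cor. 3] [cite: Rogawski1990, §4.9 Prop. 4.9.1 (b) p. 55] -/
theorem eq_plus_iff_of_eq_smul_clean [CompleteSpace E] {σ : E →+* E} {ϖ : E} {d t : ℕ} (hD : IsRamifiedQuadraticDatum σ ϖ d t)
    {f h u₀ : E} (hσf : σ f = f) (hf1 : Valued.v f = 1) (hσh : σ h = h) (hh1 : Valued.v h = 1) (hu₀ : Valued.v u₀ = 1)
    {S : Set E} (hS : S = valueSetMod σ ϖ (mstarOfRecord d) ((f * h * (u₀ * σ u₀)) • xPlus σ ϖ d)) :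
    S = valueSetMod σ ϖ (mstarOfRecord d) (xPlus σ ϖ d) ↔ ∃ z : E, z * σ z = f * h := by
  obtain ⟨hσσ, hvσ, hϖ, -, -, -, -⟩ := id hD
  haveI := Literature.NumberTheory.LocalFields.isAdicComplete_valuedInteger_of_completeSpace (K := E) hϖ
  have hu₀0 : u₀ ≠ 0 := fun h0 => by rw [h0, map_zero] at hu₀; exact zero_ne_one hu₀
  have hσe : σ (f * h * (u₀ * σ u₀)) = f * h * (u₀ * σ u₀) := by
    rw [map_mul, map_mul, map_mul, hσf, hσh, hσσ, mul_comm (σ u₀) u₀]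
  have he1 : Valued.v (f * h * (u₀ * σ u₀)) = 1 := by
    simp only [Valuation.map_mul, hvσ u₀, hf1, hh1, hu₀, mul_one]
  rw [labelPlus_iff_exists_norm_of_ray hD hS hσe he1]
  exact exists_norm_mul_iff_of_norm σ (mul_ne_zero hu₀0 ((map_ne_zero σ).2 hu₀0)) ⟨u₀, rfl⟩

/-- **THE LABEL OF THE FLIPPED VERTEX** (index two, ★ `labelPlus_map_iff_of_ray`): a letter `S = valueSetMod σ ϖ m* ((c·e) • X₊)`, `e = f·h_W·N(u₀)` as above and `c` a `σ`-fixed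
NON-norm unit, is `+` iff `f·h_W ∉ N(E^×)` — OPPOSITE to the clean vertex with the same `f`, `h_W` ((κ-b) «`K₀ = −D` at `δ = 2d`», the label half).
[cite: Serre1979, Ch. V §3 Cor. 3] [cite: LanglandsShelstad1987, §1–§3] [cite: Rogawski1990, §4.9 Prop. 4.9.1 (b) p. 55] -/
theorem eq_plus_iff_of_eq_smul_flip [CompleteSpace E] [Finite 𝓀[E]] {σ : E →+* E} {ϖ : E} {d t : ℕ} (hD : IsRamifiedQuadraticDatum σ ϖ d t)
    {f h u₀ c : E} (hσf : σ f = f) (hf1 : Valued.v f = 1) (hσh : σ h = h) (hh1 : Valued.v h = 1) (hu₀ : Valued.v u₀ = 1)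
    (hσc : σ c = c) (hcu : Valued.v c = 1) (hcN : ¬ ∃ z : E, z * σ z = c)
    {S : Set E} (hS : S = valueSetMod σ ϖ (mstarOfRecord d) ((c * (f * h * (u₀ * σ u₀))) • xPlus σ ϖ d)) :
    S = valueSetMod σ ϖ (mstarOfRecord d) (xPlus σ ϖ d) ↔ ¬ ∃ z : E, z * σ z = f * h := by
  obtain ⟨hσσ, hvσ, hϖ, -, -, -, -⟩ := id hD
  haveI := Literature.NumberTheory.LocalFields.isAdicComplete_valuedInteger_of_completeSpace (K := E) hϖ
  have hσe : σ (f * h * (u₀ * σ u₀)) = f * h * (u₀ * σ u₀) := by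
    rw [map_mul, map_mul, map_mul, hσf, hσh, hσσ, mul_comm (σ u₀) u₀]
  have he1 : Valued.v (f * h * (u₀ * σ u₀)) = 1 := by
    simp only [Valuation.map_mul, hvσ u₀, hf1, hh1, hu₀, mul_one]
  have h2 := (labelPlus_map_iff_of_ray hD (S := valueSetMod σ ϖ (mstarOfRecord d) ((f * h * (u₀ * σ u₀)) • xPlus σ ϖ d)) rfl hS hσe he1 hσc hcu).2 hcN
  rw [h2, eq_plus_iff_of_eq_smul_clean hD hσf hf1 hσh hh1 hu₀ rfl]

end Summit.HodgeConjecture.HodgeConjecture.Cruxes.H413.F0P3cDyRamNearCellFlippedLetter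

end
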